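import Summits.BirchSwinnertonDyer.BirchSwinnertonDyer.Theorems.OneSidedTwistSqueezeX9KatoDivisibilityX9ReciprocityPkFamily
import HarnessLib

set_option autoImplicit false

-- the summit and its single problem are both named `BirchSwinnertonDyer` (registry layout D-0017)
set_option linter.dupNamespace false

/-!
# Crux `KatoDivisibilityX9` (20547), line `graded_euler_loss`, stub `stub_reciprocityPkAX9` (1c′, `hLocalPk`), file E:
# MU-TRANSFER-PROOF Lemma 1 (iii) AT LEVEL `p^k` IN VALUE COORDINATES, WITH THE UNIT — `inv_q(T^{J−1−k}[φ] ∪ [ψ]) =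
# Σ_{j≤k} u_j·ι C_{k−j}(φ(t₀), ψ(Fr))`, `u_0 ∈ (ℤ/p^k)^×`

Seat `bsd-line-k6-p4` (prover-bsd-line-k6-p4-g6-0, 6th LEAD). THEOREMS ONLY; `--supports 20547` helper, closes nothing.
Level-`p^k` twin of koly's `…X9LocalQTerm.exists_unit_inv_cupProduct_eq_sum_convCoeff`.  From file D's family
`Φ_k(t,f) = Σ_j u_j·ι C_{k−j}(t, f)` in the `g(S)`-parametrisation (`φ(t₀) = g(S)t`), which kills `ω(S')𝒯'_J`:
* §1 polynomial bookkeeping over `R = ℤ/p^k`: `coeff_mul_eq_sum_range`; the truncated generating polynomial `U = Σ_{j<J} u_j X^j`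
  satisfies `U·ω̄ ≡ 0 (mod X^J)` (constant vectors `δ_0 v₀, δ_0 w₀`), `X^J = ḡ·ω̄` in `R[X]`, hence `U = ḡ·A₀` by cancelling the
  MONIC `ω̄` (`Monic.mul_right_eq_zero_iff`) — so `Σ_j u_j ι C_{k−j}(t,f) = Σ_j (A₀)_j ι C_{k−j}(g(S)t, f)` (`C(g(S)t, f) = ḡ ⋆ C(t,f)`).
* §2 the UNIT: if `(A₀)_0 ∉ R^×` then `p ∣ (A₀)_0` and the transverse class with socle value `δ_{J−1}v` (`pv = 0`, `v ≠ 0`;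
  `δ_{J−1}v ∈ ker ω(S) = g(S)𝒯_J`, file A) pairs to zero with every unramified class, contradicting `tr × ur` perfectness (file C).
* §3 **`exists_unit_inv_cupProduct_eq_sum_convCoeff_pk`**.

References: Mazur–Rubin, Mem. AMS 799 (2004) Prop. 1.3.2 [MazurRubin2004]; Rubin, PCMI 18 (2011) Prop. 1.9.5 [Rubin2011]; Howard,
Compositio 140 (2004) Prop. 3.2.4 [Howard2004HeegnerKolyvagin]; Washington, GTM 83, §7.1–7.2 [Washington1997].
-/

noncomputable section

open scoped Classical ContRepresentation

universe u

namespace Summit.BirchSwinnertonDyer.BirchSwinnertonDyer.Theorems.OneSidedTwistSqueezeX9KatoDivisibilityX9ReciprocityPkQTerm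

open CategoryTheory ContinuousCohomology Function Field ValuativeRel NumberField IsDedekindDomain Finset Polynomial
open Literature.NumberTheory.GaloisRepresentations
open Literature.NumberTheory.GaloisRepresentations.IsNonarchimedeanLocalField
open _root_.TopRep
open Literature.NumberTheory.GaloisCohomology
open Literature.NumberTheory.EllipticCurves
open Summit.BirchSwinnertonDyer.Rank1Residual.GaloisImage
open Summit.BirchSwinnertonDyer.BirchSwinnertonDyer.Rank1Residual.LocalSplitPrime
open Summit.BirchSwinnertonDyer.BirchSwinnertonDyer.Theorems.OneSidedTwistSqueezeX9KatoDivisibilityX9KolyvaginReciprocityPkStepFour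
  (toLocal_twistModPk_apply_of_mem_absInertia)
open Summit.BirchSwinnertonDyer.BirchSwinnertonDyer.Theorems.OneSidedTwistSqueezeX9KatoDivisibilityX9GradedCoreAlgebra
  (convCoeff_aeval_left_eq_sum)
open Summit.BirchSwinnertonDyer.BirchSwinnertonDyer.Theorems.OneSidedTwistSqueezeX9KatoDivisibilityX9StubReciprocityPkX9Transfer
  (convCoeff_aeval_comm)
open Summit.BirchSwinnertonDyer.BirchSwinnertonDyer.Theorems.OneSidedTwistSqueezeX9KatoDivisibilityX9ReciprocityPkAnnihilator
open Summit.BirchSwinnertonDyer.BirchSwinnertonDyer.Theorems.OneSidedTwistSqueezeX9KatoDivisibilityX9ReciprocityPkSplitValues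
open Summit.BirchSwinnertonDyer.BirchSwinnertonDyer.Theorems.OneSidedTwistSqueezeX9KatoDivisibilityX9ReciprocityPkNaturality
open Summit.BirchSwinnertonDyer.BirchSwinnertonDyer.Theorems.OneSidedTwistSqueezeX9KatoDivisibilityX9ReciprocityPkFamily

/-! ## §1 Polynomial bookkeeping -/

section Poly

variable {R : Type*} [CommRing R]

/-- `(Q₁·Q₂)_n = Σ_{j ≤ n} (Q₁)_j (Q₂)_{n−j}` (the antidiagonal as a range). [folklore] -/
theorem coeff_mul_eq_sum_range (Q₁ Q₂ : R[X]) (n : ℕ) :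
    (Q₁ * Q₂).coeff n = ∑ j ∈ range (n + 1), Q₁.coeff j * Q₂.coeff (n - j) := by
  rw [coeff_mul, Finset.Nat.sum_antidiagonal_eq_sum_range_succ_mk]

/-- Coefficients of a truncated generating polynomial `Σ_{i<N} a_i X^i`. [folklore] -/
theorem coeff_sum_C_mul_X_pow (a : ℕ → R) (N j : ℕ) :
    (∑ i ∈ range N, C (a i) * X ^ i).coeff j = if j < N then a j else 0 := by
  rw [finsetSum_coeff]
  simp only [coeff_C_mul_X_pow]
  split_ifs with h
  · rw [Finset.sum_eq_single j (fun i _ hij => if_neg (Ne.symm hij)) (fun hj => absurd (mem_range.2 h) hj), if_pos rfl]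
  · exact Finset.sum_eq_zero fun i hi => if_neg (by rintro rfl; exact h (mem_range.1 hi))

/-- `ω = (X+1)^{p^m} − 1` is monic of degree `p^m` with `ω(0) = 0`. [cite: Washington1997, §7.2] -/
theorem monic_omega {p : ℕ} (hp : p.Prime) (m : ℕ) :
    ((X + 1 : ℤ[X]) ^ p ^ m - 1).Monic ∧ ((X + 1 : ℤ[X]) ^ p ^ m - 1).natDegree = p ^ m ∧
      ((X + 1 : ℤ[X]) ^ p ^ m - 1).coeff 0 = 0 := by
  have hpm : 0 < p ^ m := pow_pos hp.pos m
  have hXC : (X + 1 : ℤ[X]) = X + C 1 := by rw [map_one]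
  have hmon : ((X + 1 : ℤ[X]) ^ p ^ m).Monic := by rw [hXC]; exact (monic_X_add_C 1).pow _
  have hdeg : ((X + 1 : ℤ[X]) ^ p ^ m).natDegree = p ^ m := by
    rw [hXC, (monic_X_add_C 1).natDegree_pow, natDegree_X_add_C, mul_one]
  have hlt : (1 : ℤ[X]).degree < ((X + 1 : ℤ[X]) ^ p ^ m).degree := by
    rw [degree_one, degree_eq_natDegree hmon.ne_zero, hdeg]
    exact_mod_cast hpm
  refine ⟨hmon.sub_of_left hlt, ?_, ?_⟩
  · rw [natDegree_sub_eq_left_of_natDegree_lt (by rw [natDegree_one, hdeg]; exact hpm), hdeg]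
  · rw [coeff_sub, coeff_zero_eq_eval_zero, eval_pow, eval_add, eval_X, eval_one, zero_add, one_pow,
      coeff_one_zero, sub_self]

end Poly

/-! ## §2–§3 The identity in value coordinates with the unit -/

section QTerm

variable {K : Type u} [Field K] [NumberField K] {p : ℕ} [Fact p.Prime] {k₀ : ℕ}
  {M M' : Type u} [AddCommGroup M] [TopologicalSpace M] [DiscreteTopology M] [Finite M]
  [AddCommGroup M'] [TopologicalSpace M'] [DiscreteTopology M'] [Finite M']
  (ρ : DiscreteGaloisModule K M) (ρ' : DiscreteGaloisModule K M')
  (hM : ∀ x : M, p ^ k₀ • x = 0) (hM' : ∀ x : M', p ^ k₀ • x = 0) (κ : ZpExtension K p) (J : ℕ)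
  (q : HeightOneSpectrum (𝓞 K)) [Fact (Ideal.absNorm q.asIdeal).Prime]
  [NeZero ((Ideal.absNorm q.asIdeal : ℕ) : q.adicCompletion K)]
  [LocallyCompactSpace (absoluteGaloisGroup (q.adicCompletion K))]

omit [Fact p.Prime] [TopologicalSpace M] [DiscreteTopology M] [Finite M] in
/-- A non-zero element of a `p^k`-torsion group has a non-zero multiple killed by `p`. [folklore] -/
theorem exists_ne_zero_prime_smul_eq_zero {n : ℕ} {x : M} (hx : x ≠ 0) (hn : p ^ n • x = 0) :
    ∃ v : M, v ≠ 0 ∧ p • v = 0 := by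
  induction n generalizing x with
  | zero => exact absurd (by rwa [pow_zero, one_smul] at hn) hx
  | succ n ih =>
    by_cases h : p ^ n • x = 0
    · exact ih hx h
    · exact ⟨p ^ n • x, h, by rw [smul_smul, ← pow_succ', hn]⟩

set_option maxHeartbeats 800000 in
/-- **MU-TRANSFER-PROOF Lemma 1 (iii) on the level-`p^k` local twists, up to a UNIT.**  At a finite place `q ∤ p` of the
number field `K` with `ρ`, `ρ′` unramified, `p^k ∣ N(q) − 1`, `χ̄_ℓ` onto on inertia, an `E`-split arithmetic Frobenius
`Fr` of depth `m` (`m + 1 ≤ J`), a tame generator `t₀`, a perfect `e : M × M′ → μ_{p^k}` with `ι e(v₀,w₀) = 1`, a perfect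
family `inv`, the level `J = p^m + deg g` with `g·ω + p^k·h = X^J` (`ω = (X+1)^{p^m} − 1`; e.g. `J = 2p^m k`, `g = m_ω·ω`),
ANY local pairing `P` with bilinear map the Gorenstein pairing and ANY equivariant `S` acting as the shift: there is
`u : ℕ → ℤ/p^k` with **`u 0` a unit** such that for every `k' < J`, every cocycle `φ` of `𝒯_J^{(k)}|_q` with TRANSVERSE class
and every cocycle `ψ` of `𝒯′_J^{(k)}|_q` vanishing on inertia,
`inv_q(T^{J−1−k'}[φ] ∪_P [ψ]) = Σ_{j ≤ k'} u_j · ι(C_{k'−j}(φ(t₀), ψ(Fr)))`.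
[cite: MazurRubin2004, Prop. 1.3.2 (p. 12)] [cite: Rubin2011, Prop. 1.9.5 (p. 16)] [cite: Howard2004HeegnerKolyvagin, Prop. 3.2.4] -/
theorem exists_unit_inv_cupProduct_eq_sum_convCoeff_pk (hp : p ≠ 2)
    {e : M →+ M' →+ DiscreteGaloisModule.MuCarrier K (p ^ k₀)}
    (he : ∀ (g : absoluteGaloisGroup K) (a : M) (b : M'),
      e (ρ g a) (ρ' g b) = DiscreteGaloisModule.mu K (p ^ k₀) g (e a b))
    (hnd : ∀ b : M', (∀ a : M, e a b = 0) → b = 0)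
    (hsurj : ∀ χ : M →+ DiscreteGaloisModule.MuCarrier K (p ^ k₀), ∃ b : M', ∀ a, e a b = χ a)
    (ι : DiscreteGaloisModule.MuCarrier K (p ^ k₀) →+ ZMod (p ^ k₀)) (hι : Function.Injective ι)
    {v₀ : M} {w₀ : M'} (h1 : ι (e v₀ w₀) = 1)
    (hunr : GaloisRep.IsUnramifiedAt q ρ) (hunr' : GaloisRep.IsUnramifiedAt q ρ')
    (hqp : (p : 𝓞 K) ∉ q.asIdeal) (hpl : p ^ k₀ ∣ Ideal.absNorm q.asIdeal - 1)
    (hχI : ∀ u : (ZMod (Ideal.absNorm q.asIdeal))ˣ, ∃ t ∈ absInertia (q.adicCompletion K),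
      modPCyclotomicCharacterZMod (q.adicCompletion K) (Ideal.absNorm q.asIdeal) t = u)
    {Fr : absoluteGaloisGroup (q.adicCompletion K)} (hFr : IsAbsArithFrob Fr)
    (hsplit : ρ (absGaloisRestrict K (q.adicCompletion K) Fr) = 1)
    (hsplit' : ρ' (absGaloisRestrict K (q.adicCompletion K) Fr) = 1) {m : ℕ} (hm : m + 1 ≤ J) (hk₀ : 1 ≤ k₀)
    (hFrm : absGaloisRestrict K (q.adicCompletion K) Fr ∈ κ.layerSubgroup m)
    (hFrm' : absGaloisRestrict K (q.adicCompletion K) Fr ∉ κ.layerSubgroup (m + 1))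
    {t₀ : absoluteGaloisGroup (q.adicCompletion K)} (ht₀ : t₀ ∈ absInertia (q.adicCompletion K))
    (hgen : ∀ u : (ZMod (Ideal.absNorm q.asIdeal))ˣ,
      u ∈ Subgroup.zpowers (modPCyclotomicCharacterZMod (q.adicCompletion K) (Ideal.absNorm q.asIdeal) t₀))
    (inv : LocalInvariants K (p ^ k₀)) (hperf : inv.IsPerfect)
    (P : ContPairing (GaloisRep.toLocal q (κ.twistModPk ρ hM J)).toTopRep
      (GaloisRep.toLocal q (κ.invTwist.twistModPk ρ' hM' J)).toTopRep
      ((DiscreteGaloisModule.mu K (p ^ k₀)).toLocal (Sum.inr q)).toTopRep)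
    (hP : ∀ x y, P.toLin x y = gorensteinPairing e J x y)
    (S : (GaloisRep.toLocal q (κ.twistModPk ρ hM J)).toContRepresentation →ⁱL
      (GaloisRep.toLocal q (κ.twistModPk ρ hM J)).toContRepresentation)
    (hS : ∀ x, S x = shiftEnd M J x) {g h : ℤ[X]} (hg : g.Monic) (hdeg : p ^ m + g.natDegree = J)
    (hrel : g * ((X + 1 : ℤ[X]) ^ p ^ m - 1) + ((p ^ k₀ : ℕ) : ℤ[X]) * h = X ^ J) :
    ∃ u : ℕ → ZMod (p ^ k₀), IsUnit (u 0) ∧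
      ∀ k < J, ∀ (φ : contOneCocycles (GaloisRep.toLocal q (κ.twistModPk ρ hM J)).toTopRep)
        (ψ : contOneCocycles (GaloisRep.toLocal q (κ.invTwist.twistModPk ρ' hM' J)).toTopRep),
        oneCocycleClass _ φ ∈ DiscreteGaloisModule.transverseSubgroup
          (GaloisRep.toLocal q (κ.twistModPk ρ hM J))
          (CyclotomicField (Ideal.absNorm q.asIdeal) (q.adicCompletion K)) →
        (∀ t ∈ absInertia (q.adicCompletion K), ψ.1 t = 0) →
        inv (Sum.inr q) (P.cupProduct
            ((galoisCohomology.map S 1)^[J - 1 - k] (oneCocycleClass _ φ)) (oneCocycleClass _ ψ)) =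
          ∑ j ∈ Finset.range (k + 1), u j * ι (convCoeff e J (k - j) (φ.1 t₀) (ψ.1 Fr)) := by
  classical
  have hpP : p.Prime := Fact.out
  have hJ : 0 < J := by omega
  haveI : Fact (1 < p ^ k₀) := ⟨Nat.one_lt_pow (by omega) hpP.one_lt⟩
  set ω : ℤ[X] := (X + 1 : ℤ[X]) ^ p ^ m - 1 with hωdef
  obtain ⟨hωmon, hωdeg, hω0⟩ := monic_omega hpP m
  -- the relation modulo `p^k`, coefficientwise
  have hrel' : ∀ i, i < J → ((p ^ k₀ : ℕ) : ℤ) ∣ (g * ω - X ^ J).coeff i := by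
    intro i _
    have : g * ω - X ^ J = -(((p ^ k₀ : ℕ) : ℤ[X]) * h) := by rw [← hrel]; ring
    rw [this, coeff_neg, ← C_eq_natCast, coeff_C_mul]
    exact (dvd_mul_right _ _).neg_right
  -- the transverse value module (file A)
  have hval : LinearMap.ker (aeval (shiftEnd M J) ω) = LinearMap.range (aeval (shiftEnd M J) g) :=
    ker_aeval_eq_range_aeval_of_monic_of_rel hM hωmon hg (by rw [hωdeg]; exact hdeg) hrel'
  -- ### file D: the family in the `g(S)`-parametrisation
  obtain ⟨u, hmain, hkill⟩ := exists_inv_cupProduct_eq_sum_convCoeff_pk ρ ρ' hM hM' κ J q ι hι h1 hunr hunr' hqp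
    hpl hχI hFr hsplit hsplit' hm hk₀ hFrm hFrm' ht₀ hgen inv P hP S hS hrel'
  -- ### §1 polynomial bookkeeping over `R = ℤ/p^k`
  set U : (ZMod (p ^ k₀))[X] := ∑ i ∈ range J, C (u i) * X ^ i with hU
  set ωb : (ZMod (p ^ k₀))[X] := ω.map (Int.castRingHom (ZMod (p ^ k₀))) with hωb
  set gb : (ZMod (p ^ k₀))[X] := g.map (Int.castRingHom (ZMod (p ^ k₀))) with hgb
  have hUcoeff : ∀ j, j < J → U.coeff j = u j := fun j hj => by
    rw [hU, coeff_sum_C_mul_X_pow, if_pos hj]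
  have hωbmon : ωb.Monic := hωmon.map _
  -- `ι C_i(δ_0 v₀, ω(S') δ_0 w₀) = ω_i`
  have hδω : ∀ i, i < J → ι (convCoeff e J i (Pi.single (⟨0, hJ⟩ : Fin J) v₀)
      (aeval (shiftEnd M' J) ω (Pi.single (⟨0, hJ⟩ : Fin J) w₀))) = (ω.coeff i : ZMod (p ^ k₀)) := by
    intro i hi
    rw [← convCoeff_aeval_comm e ω hi, convCoeff_aeval_left_eq_sum e ω hi, map_sum,
      Finset.sum_eq_single_of_mem i (mem_range.2 (Nat.lt_succ_self i))]
    · rw [Nat.sub_self, convCoeff_single_zero_single_zero e hJ, if_pos rfl, map_zsmul, h1, zsmul_eq_mul, mul_one]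
    · intro a ha hai
      rw [mem_range] at ha
      rw [convCoeff_single_zero_single_zero e (by omega), if_neg (by omega), smul_zero, map_zero]
  -- Claim A: `U·ω̄ ≡ 0 (mod X^J)`
  have hA : ∀ n, n < J → (U * ωb).coeff n = 0 := by
    intro n hn
    rw [coeff_mul_eq_sum_range, ← hkill n hn (Pi.single (⟨0, hJ⟩ : Fin J) v₀) (Pi.single (⟨0, hJ⟩ : Fin J) w₀)]
    refine Finset.sum_congr rfl fun j hj => ?_
    rw [mem_range] at hj
    rw [hUcoeff j (by omega), hδω _ (by omega), hωb, coeff_map, eq_intCast]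
  -- Claim B: `U·ω̄ = X^J · A₀`
  obtain ⟨A₀, hA₀⟩ : X ^ J ∣ U * ωb := X_pow_dvd_iff.2 hA
  -- Claim C: `X^J = ḡ·ω̄` in `R[X]`
  have hC : (X : (ZMod (p ^ k₀))[X]) ^ J = gb * ωb := by
    have hmap := congrArg (Polynomial.map (Int.castRingHom (ZMod (p ^ k₀)))) hrel
    rw [Polynomial.map_add, Polynomial.map_mul, Polynomial.map_mul, Polynomial.map_pow, map_X,
      Polynomial.map_natCast] at hmap
    have hz : ((p ^ k₀ : ℕ) : (ZMod (p ^ k₀))[X]) = 0 := by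
      rw [← C_eq_natCast, ZMod.natCast_self, C_0]
    rw [hz, zero_mul, add_zero] at hmap
    exact hmap.symm
  -- Claim D: `U = ḡ·A₀`
  have hD : U = gb * A₀ := by
    have h0 : ωb * (U - gb * A₀) = 0 := by
      rw [mul_sub, mul_comm ωb U, hA₀, hC]; ring
    exact sub_eq_zero.1 ((hωbmon.mul_right_eq_zero_iff).1 h0)
  -- `(ḡ·P_{t,f})_i = ι C_i(g(S)t, f)` and the conversion `Σ u_j ι C_{n−j}(t,f) = Σ (A₀)_j ι C_{n−j}(g(S)t, f)`
  have hconv : ∀ n, n < J → ∀ (t : Fin J → M) (f : Fin J → M'),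
      ∑ j ∈ range (n + 1), u j * ι (convCoeff e J (n - j) t f) =
        ∑ j ∈ range (n + 1), A₀.coeff j * ι (convCoeff e J (n - j) (aeval (shiftEnd M J) g t) f) := by
    intro n hn t f
    set Pc : (ZMod (p ^ k₀))[X] := ∑ i ∈ range J, C (ι (convCoeff e J i t f)) * X ^ i with hPc
    have hPcc : ∀ i, i < J → Pc.coeff i = ι (convCoeff e J i t f) := fun i hi => by
      rw [hPc, coeff_sum_C_mul_X_pow, if_pos hi]
    -- LHS = (U·Pc)_n
    have hL : ∑ j ∈ range (n + 1), u j * ι (convCoeff e J (n - j) t f) = (U * Pc).coeff n := by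
      rw [coeff_mul_eq_sum_range]
      refine Finset.sum_congr rfl fun j hj => ?_
      rw [mem_range] at hj
      rw [hUcoeff j (by omega), hPcc _ (by omega)]
    -- `(ḡ·Pc)_i = ι C_i(g(S) t, f)`
    have hgP : ∀ i, i < J → (gb * Pc).coeff i = ι (convCoeff e J i (aeval (shiftEnd M J) g t) f) := by
      intro i hi
      rw [coeff_mul_eq_sum_range, convCoeff_aeval_left_eq_sum e g hi, map_sum]
      refine Finset.sum_congr rfl fun a ha => ?_
      rw [mem_range] at ha
      rw [hgb, coeff_map, eq_intCast, hPcc _ (by omega), map_zsmul, zsmul_eq_mul]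
    rw [hL, hD, mul_comm gb A₀, mul_assoc, coeff_mul_eq_sum_range]
    refine Finset.sum_congr rfl fun j hj => ?_
    rw [mem_range] at hj
    rw [hgP _ (by omega)]
  -- ### §2 the UNIT
  have hI : ∀ t ∈ absInertia (q.adicCompletion K), ∀ x : Fin J → M,
      GaloisRep.toLocal q (κ.twistModPk ρ hM J) t x = x :=
    fun _ ht x => toLocal_twistModPk_apply_of_mem_absInertia κ ρ hM J q hunr hqp ht x
  have hunit : IsUnit (A₀.coeff 0) := by
    by_contra hnu
    -- `p ∣ (A₀)_0`
    set c := A₀.coeff 0 with hc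
    have hdvd : p ∣ c.val := by
      by_contra hnd'
      apply hnu
      have hcop : c.val.Coprime (p ^ k₀) :=
        Nat.Coprime.pow_right k₀ (Nat.coprime_comm.mp (hpP.coprime_iff_not_dvd.mpr hnd'))
      have := (ZMod.isUnit_iff_coprime c.val (p ^ k₀)).2 hcop
      rwa [ZMod.natCast_zmod_val] at this
    obtain ⟨c', hc'⟩ := hdvd
    -- a socle vector `v`: `v ≠ 0`, `p v = 0`
    have hv₀ : v₀ ≠ 0 := by
      rintro rfl
      rw [map_zero, AddMonoidHom.zero_apply, map_zero] at h1
      exact zero_ne_one h1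
    obtain ⟨v, hv, hpv⟩ := exists_ne_zero_prime_smul_eq_zero (p := p) hv₀ (hM v₀)
    -- `δ_{J−1} v ∈ ker ω(S) = g(S)𝒯_J`
    have hJ1 : J - 1 < J := by omega
    set δ : Fin J → M := Pi.single (⟨J - 1, hJ1⟩ : Fin J) v with hδ
    have hδker : δ ∈ LinearMap.ker (aeval (shiftEnd M J) ω) := by
      rw [LinearMap.mem_ker]
      funext j
      rw [hδ, aeval_shiftEnd_single_apply, Pi.zero_apply]
      split_ifs with hle
      · have : (j : ℕ) - (J - 1) = 0 := by have := j.2; omega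
        rw [this, hω0, zero_smul]
      · rfl
    rw [hval, LinearMap.mem_range] at hδker
    obtain ⟨t₁, ht₁⟩ := hδker
    -- the transverse class with value `δ`
    obtain ⟨φ₁, hφ₁tr, hφ₁val⟩ := exists_transverse_cocycle_apply_eq_aeval ρ hM κ J q hunr hqp hpl hχI hFr hsplit hm
      hFrm hFrm' ht₀ hgen hrel' t₁
    have hφ₁ne : oneCocycleClass _ φ₁ ≠ 0 := by
      intro h0
      obtain ⟨ev, hev⟩ := exists_evalInertia (GaloisRep.toLocal q (κ.twistModPk ρ hM J)) hI ht₀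
      have h1' : ev (oneCocycleClass _ φ₁) = δ := by rw [hev, hφ₁val, ht₁]
      have hδ0 : δ = 0 := by rw [← h1', h0]; exact map_zero ev
      have := congrFun hδ0 ⟨J - 1, hJ1⟩
      rw [Pi.zero_apply, hδ, Pi.single_eq_same] at this
      exact hv this
    -- it pairs to zero with every unramified cocycle
    obtain ⟨ψ, hψ0, hne⟩ := exists_unramified_cupProduct_ne_zero_of_transverse_pk ρ ρ' hM hM' κ J q hp he hnd hsurj
      hunr hunr' hqp hpl hχI inv hperf P hP hφ₁tr hφ₁ne
    apply hne
    have hmainJ := hmain (J - 1) hJ1 φ₁ ψ t₁ hφ₁tr hψ0 hφ₁val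
    rw [Nat.sub_self, Function.iterate_zero, id] at hmainJ
    rw [hmainJ, hconv _ hJ1, ht₁]
    -- `C_i(δ_{J−1} v, f) = [i = J−1] e(v, f_0)`
    have hCδ : ∀ i, i < J → ∀ f : Fin J → M', convCoeff e J i δ f =
        if i = J - 1 then e v (f ⟨0, hJ⟩) else 0 := by
      intro i hi f
      rw [hδ, ← shiftEnd_pow_single_zero' hJ1 v, convCoeff_shiftEnd_pow_left_eq' e (J - 1) hi]
      by_cases hiJ : i = J - 1
      · rw [if_pos (by omega), if_pos hiJ, hiJ, Nat.sub_self, convCoeff_def, Finset.sum_range_one, Nat.sub_zero,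
          coeffFun_of_lt _ hJ, coeffFun_of_lt _ hJ, Pi.single_eq_same]
      · rw [if_neg (by omega), if_neg hiJ]
    rw [Finset.sum_eq_single_of_mem 0 (mem_range.2 (Nat.succ_pos _))]
    · rw [Nat.sub_zero, hCδ _ hJ1, if_pos rfl]
      change c * ι (e v (ψ.1 Fr ⟨0, hJ⟩)) = 0
      have hpe : (p : ZMod (p ^ k₀)) * ι (e v (ψ.1 Fr ⟨0, hJ⟩)) = 0 := by
        rw [← nsmul_eq_mul, ← map_nsmul, ← AddMonoidHom.nsmul_apply, ← map_nsmul, hpv, map_zero,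
          AddMonoidHom.zero_apply, map_zero]
      rw [← ZMod.natCast_zmod_val c, hc', Nat.cast_mul, mul_comm (p : ZMod (p ^ k₀)), mul_assoc, hpe, mul_zero]
    · intro j hj hj0
      rw [mem_range] at hj
      rw [hCδ _ (by omega), if_neg (by omega), map_zero, mul_zero]
  -- ### §3 conclusion
  refine ⟨fun j => A₀.coeff j, hunit, fun k hk φ ψ hφ hψ => ?_⟩
  obtain ⟨t, ht⟩ := exists_cocycle_apply_eq_aeval ρ hM κ J q hunr hqp hpl hχI hsplit hm hFrm hFrm' hval φ ht₀
  rw [hmain k hk φ ψ t hφ hψ ht, hconv k hk, ← ht]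

end QTerm

end Summit.BirchSwinnertonDyer.BirchSwinnertonDyer.Theorems.OneSidedTwistSqueezeX9KatoDivisibilityX9ReciprocityPkQTerm

end
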